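import Summits.QuantumFields.YangMills.Theorems.UnitScaleTiltProp7CovariantPlaquetteExpansion
import Literature.MathematicalPhysics.QuantumFieldTheory.Balaban1983to89.T4AdjointCovarianceUnitary
import Literature.MathematicalPhysics.QuantumFieldTheory.Balaban1983to89.T4SegmentCurvature
import Literature.MathematicalPhysics.QuantumLattice.GaugeGroupsProofs
import Literature.Analysis.Calculus.BCHProductLowOrder
import Literature.Analysis.Calculus.ExpDifferentialLogQuotient
import HarnessLib

/-!
# `AlphaInputsT3ACv3PerturbedPlaquette` — STRATEGY B for 2′, the (FL) row under OWNER RULING g24-№4 («Newton∕IFT on the (LL) engine»): **THE COVARIANT PLAQUETTE LEDGER OF A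
# MULTIPLICATIVE PERTURBATION `U′_b = e^{a_b}·U_b` AT AN ARBITRARY BACKGROUND** — lane `pub-balaban3d` ∕ cell `ym3-torus`, seat `ym-ust-19936-w4` (g0)

WHY (cell `ym3-torus` STATUS 2026-08-28, this seat's CLAIM (P); companion of `…v3NewtonShell`).  In every kinematic execution of RULING №4 the exact lift is reached as a multiplicative
correction `U′ = e^{a}·U₀` of a candidate `U₀` whose bond variables are `O(1)` from the identity (the datum's transports over `≥ L^k` fine bonds are `O(1)`; no global small gauge
exists on `Ω_{k+1}(h)` in general).  What is small is `a` and the CURVATURE of `U₀`.  The plaquettes of `U′` are therefore read through the COVARIANT curl of `a` at the background: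
for a plaquette with bonds `b₁ = (x,μ)`, `b₂ = (x+e_μ,ν)`, `b₃ = (x+e_ν,μ)`, `b₄ = (x,ν)` and `W = U(∂p) = U₁U₂U₃⁻¹U₄⁻¹`,
  `U′(∂p) = e^{a₁} · e^{Ad(U₁)a₂} · e^{−Ad(U₁U₂U₃⁻¹)a₃} · e^{−Ad(W)a₄} · W`                                  (§2, exact, any `U`),
so `‖U′(∂p) − 1‖ ≤ ‖U(∂p) − 1‖ + ‖a₁ + Ad(U₁)a₂ − Ad(U₁U₂U₃⁻¹)a₃ − Ad(W)a₄‖ + (e^{4δ} − 1 − 4δ)` for `‖a_b‖ ≤ δ` (§3; `≤ 16δ²` when `4δ ≤ 1`), and conversely the covariant curl is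
bounded by the two plaquette deviations plus the same second-order term.  NO smallness of the `U_b` is used — only `‖g X g*‖ = ‖X‖` and `e^{gXg*} = g e^{X} g*` for unitary `g`.
* §1 normed-algebra letters: ★ `norm_prodExp_sub_one_sub_sum_le` (`‖Πe^{Yᵢ} − 1 − ΣYᵢ‖ ≤ e^{Σ‖Yᵢ‖} − 1 − Σ‖Yᵢ‖`, the second-order companion of `BCH.norm_prodExp_sub_one_le`, from the
  tree's `OneLinkLaplace.norm_exp_sub_one_sub_le`), the four-factor numeric form `≤ 16δ²`.
* §2 `coe_plaqHol_perturb_eq` — the displayed identity in `M_n(ℂ)`.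
* §3 ★★ `dist1_plaqHol_perturb_le` ∕ `norm_covCurl_le` ∕ `dist1_plaqHol_perturb_le_flatLast` (the last slot read as `−a₄`, extra `2δ·dist1 U(∂p)`, via the tree's
  `Prop7CovariantCoercivity.norm_conj_sub_self_le'`).  Letters already in the tree (`QuantumLattice.coe_inv_eq_star`, `T4SegmentCurvature.exp_sub_one_sub_mono`, …) are used BY NAME.
Pure bookkeeping on [Balaban1985Averaging] (9) p.19's plaquette variables; count-neutral helper toward R3 2′ (items 19936∕19935); (FL) NOT proved here; registry untouched; nothing about d = 4,
the continuum, or a mass gap; YM₃ on T³ is rung R3, not Clay.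

References: T. Bałaban, Commun. Math. Phys. 98 (1985) 17–51 [Balaban1985Averaging] ((8)–(9) pp.18–19, (19) p.21, (57) p.27); W. Rossmann, *Lie Groups*, OUP 2002 [Rossmann2002] (§1.3).
-/

set_option autoImplicit false

noncomputable section

open scoped Matrix.Norms.L2Operator
open NormedSpace

namespace Summit.QuantumFields.YangMills.Theorems.PerturbedPlaquette

open Literature.MathematicalPhysics.QuantumFieldTheory.Balaban1983to89
open Literature.MathematicalPhysics.QuantumFieldTheory.Balaban1983to89.T4AdjointCovarianceUnitary (exp_conj_unitary opNorm_conj_unitary)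
open Literature.Analysis.Calculus.BCH (ns ns_nonneg ns_cons ns_nil norm_sum_le_ns norm_prodExp_sub_one_le norm_mul_sub_one_le_of_le)
open Literature.Analysis.Calculus.ExpDifferential (norm_exp_sub_one_le_exp_norm_sub_one)
open Literature.MathematicalPhysics.QuantumFieldTheory.OneLinkLaplace (norm_exp_sub_one_sub_le)
open Literature.MathematicalPhysics.QuantumFieldTheory.Balaban1983to89.T4SegmentCurvature (exp_sub_one_sub_mono)
open Literature.MathematicalPhysics.QuantumLattice (coe_inv_eq_star)
open Summit.QuantumFields.YangMills.Theorems.Prop7CovariantCoercivity (norm_conj_sub_self_le')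

/-! ## §1 Normed-algebra letters: products of exponentials to second order -/

section Algebra

variable {𝔸 : Type*} [NormedRing 𝔸] [NormedAlgebra ℂ 𝔸] [CompleteSpace 𝔸]

/-- **★ THE PRODUCT OF EXPONENTIALS TO SECOND ORDER**: `‖e^{Y₁}⋯e^{Y_m} − 1 − (Y₁ + ⋯ + Y_m)‖ ≤ e^{Σ‖Yᵢ‖} − 1 − Σ‖Yᵢ‖` — induction on the list with
`e^{a}P − 1 − (a + S) = (e^{a} − 1)(P − 1) + (e^{a} − 1 − a) + (P − 1 − S)`. [cite: Rossmann2002, §1.3 Theorem 1, remark after (5)] -/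
theorem norm_prodExp_sub_one_sub_sum_le (l : List 𝔸) : ‖(l.map exp).prod - 1 - l.sum‖ ≤ Real.exp (ns l) - 1 - ns l := by
  induction l with
  | nil => simp [ns_nil]
  | cons a l ih =>
    rw [List.map_cons, List.prod_cons, List.sum_cons, ns_cons]
    set P := (l.map exp).prod with hP
    set S := l.sum with hS
    have e : exp a * P - 1 - (a + S) = (exp a - 1) * (P - 1) + (exp a - 1 - a) + (P - 1 - S) := by noncomm_ring
    rw [e]
    have h1 : ‖exp a - 1‖ ≤ Real.exp ‖a‖ - 1 := norm_exp_sub_one_le_exp_norm_sub_one a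
    have h2 : ‖P - 1‖ ≤ Real.exp (ns l) - 1 := norm_prodExp_sub_one_le l
    have h3 := norm_exp_sub_one_sub_le a
    have h1' : 0 ≤ Real.exp ‖a‖ - 1 := by linarith [Real.add_one_le_exp ‖a‖, norm_nonneg a]
    have h2' : 0 ≤ Real.exp (ns l) - 1 := by linarith [Real.add_one_le_exp (ns l), ns_nonneg l]
    calc ‖(exp a - 1) * (P - 1) + (exp a - 1 - a) + (P - 1 - S)‖
        ≤ ‖(exp a - 1) * (P - 1)‖ + ‖exp a - 1 - a‖ + ‖P - 1 - S‖ := norm_add₃_le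
      _ ≤ (Real.exp ‖a‖ - 1) * (Real.exp (ns l) - 1) + (Real.exp ‖a‖ - 1 - ‖a‖) + (Real.exp (ns l) - 1 - ns l) := by
          gcongr
          exact (norm_mul_le _ _).trans (mul_le_mul h1 h2 (norm_nonneg _) h1')
      _ = Real.exp (‖a‖ + ns l) - 1 - (‖a‖ + ns l) := by rw [Real.exp_add]; ring

/-- **FOUR FACTORS, NUMERIC FORM**: for `‖Yᵢ‖ ≤ δ` (`i = 1,…,4`), `‖e^{Y₁}e^{Y₂}e^{Y₃}e^{Y₄} − 1 − (Y₁+Y₂+Y₃+Y₄)‖ ≤ e^{4δ} − 1 − 4δ`, and `e^{4δ} − 1 − 4δ ≤ 16δ²` once `4δ ≤ 1`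
(`Real.abs_exp_sub_one_sub_id_le`). [folklore] -/
theorem norm_prodExp_four_sub_one_sub_sum_le (Y₁ Y₂ Y₃ Y₄ : 𝔸) {δ : ℝ} (h₁ : ‖Y₁‖ ≤ δ) (h₂ : ‖Y₂‖ ≤ δ) (h₃ : ‖Y₃‖ ≤ δ) (h₄ : ‖Y₄‖ ≤ δ) :
    ‖exp Y₁ * exp Y₂ * exp Y₃ * exp Y₄ - 1 - (Y₁ + Y₂ + Y₃ + Y₄)‖ ≤ Real.exp (4 * δ) - 1 - 4 * δ := by
  have h := norm_prodExp_sub_one_sub_sum_le [Y₁, Y₂, Y₃, Y₄]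
  simp only [List.map_cons, List.map_nil, List.prod_cons, List.prod_nil, mul_one, List.sum_cons, List.sum_nil, add_zero,
    ns_cons, ns_nil] at h
  rw [← mul_assoc, ← mul_assoc, ← add_assoc, ← add_assoc] at h
  refine h.trans (exp_sub_one_sub_mono (by positivity) ?_)
  linarith

/-- `e^{4δ} − 1 − 4δ ≤ 16δ²` for `0 ≤ δ`, `4δ ≤ 1`. [folklore] -/
theorem exp_four_mul_sub_le_sq {δ : ℝ} (hδ : 0 ≤ δ) (h4 : 4 * δ ≤ 1) : Real.exp (4 * δ) - 1 - 4 * δ ≤ 16 * δ ^ 2 := by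
  have h := Real.abs_exp_sub_one_sub_id_le (x := 4 * δ) (by rw [abs_of_nonneg (by positivity)]; exact h4)
  have := le_abs_self (Real.exp (4 * δ) - 1 - 4 * δ)
  nlinarith

end Algebra

/-! ## §2 The perturbed plaquette variable, exactly -/

section Matrices

variable {n : Type*} [Fintype n] [DecidableEq n]

/-- `g · e^{X} = e^{gXg*} · g` for `g ∈ SU(n)` (`exp_conj_unitary`). [cite: Balaban1985Averaging, (57) p.27] -/
theorem coe_mul_exp_eq (g : Matrix.specialUnitaryGroup n ℂ) (X : Matrix n n ℂ) :
    (g : Matrix n n ℂ) * exp X = exp ((g : Matrix n n ℂ) * X * star (g : Matrix n n ℂ)) * (g : Matrix n n ℂ) := by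
  rw [exp_conj_unitary ⟨(g : Matrix n n ℂ), g.2.1⟩ X]
  simp only [mul_assoc, Unitary.star_mul_self_of_mem (g.2.1), mul_one]

/-- `‖gXg*‖ = ‖X‖` for `g ∈ SU(n)`. [cite: Balaban1985Averaging, (19) p.21] -/
theorem norm_conj_SU (g : Matrix.specialUnitaryGroup n ℂ) (X : Matrix n n ℂ) : ‖(g : Matrix n n ℂ) * X * star (g : Matrix n n ℂ)‖ = ‖X‖ :=
  opNorm_conj_unitary ⟨(g : Matrix n n ℂ), g.2.1⟩ X

variable [Nonempty n]

/-- On `SU(n)` the interface distance `dist1` IS the operator-norm distance to `1` (the tree's `UnitaryModel` instance; `rfl`). [cite: Balaban1985Averaging, (19) p.21] -/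
theorem dist1_SU_eq (g : Matrix.specialUnitaryGroup n ℂ) : GaugeGroup.dist1 g = ‖(g : Matrix n n ℂ) - 1‖ := rfl

omit [Nonempty n] in
/-- **THE CANONICAL PERTURBED FIELD** `U′_b := expSU(a_b)·U_b` for `a : bonds → 𝔰𝔲(n)` has matrix `e^{a_b}·U_b` (so it meets the hypothesis `hU'` of the ledger below), and `a_b* = −a_b`.
[cite: Balaban1988Convergent, (1.19) p.250] -/
theorem coe_expSU_mul (X : T4AdjointCovarianceUnitary.lieSU n) (g : Matrix.specialUnitaryGroup n ℂ) :
    ((T4AdjointCovarianceUnitary.expSU X * g : Matrix.specialUnitaryGroup n ℂ) : Matrix n n ℂ) = exp (X : Matrix n n ℂ) * (g : Matrix n n ℂ) ∧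
      star (X : Matrix n n ℂ) = -(X : Matrix n n ℂ) :=
  ⟨by rw [Submonoid.coe_mul, T4AdjointCovarianceUnitary.coe_expSU], (T4AdjointCovarianceUnitary.mem_lieSU_iff.mp X.2).1⟩

variable {P : Params} {j : ℕ}
set_option maxHeartbeats 400000 in
/-- **THE PERTURBED PLAQUETTE, EXACTLY.**  For bond fields `U, U′ : bonds → SU(n)` with `U′_b = e^{a_b}·U_b`, `a_b* = −a_b`, and a plaquette `p` with bonds `b₁ = (x,μ)`, `b₂ = (x+e_μ,ν)`,
`b₃ = (x+e_ν,μ)`, `b₄ = (x,ν)`, `W := U(∂p) = U₁U₂U₃⁻¹U₄⁻¹`:  `U′(∂p) = e^{a₁}·e^{U₁a₂U₁*}·e^{−g a₃ g*}·e^{−W a₄ W*}·W` with `g = U₁U₂U₃⁻¹` — each perturbation is transported to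
the base point by the background.  No smallness of anything. [cite: Balaban1985Averaging, (8)–(9) pp.18–19] -/
theorem coe_plaqHol_perturb_eq (U U' : GaugeField P j (Matrix.specialUnitaryGroup n ℂ)) (a : PBond P j → Matrix n n ℂ)
    (hstar : ∀ b, star (a b) = -a b) (hU' : ∀ b, ((U' b : Matrix.specialUnitaryGroup n ℂ) : Matrix n n ℂ) = exp (a b) * (U b : Matrix n n ℂ))
    (p : Plaq P j) :
    ((GaugeField.plaqHol U' p : Matrix.specialUnitaryGroup n ℂ) : Matrix n n ℂ) =
      exp (a ⟨p.src, p.μ⟩) *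
      exp ((U ⟨p.src, p.μ⟩ : Matrix n n ℂ) * a ⟨p.src.shift p.μ, p.ν⟩ * star (U ⟨p.src, p.μ⟩ : Matrix n n ℂ)) *
      exp (-(((U ⟨p.src, p.μ⟩ * U ⟨p.src.shift p.μ, p.ν⟩ * (U ⟨p.src.shift p.ν, p.μ⟩)⁻¹ : Matrix.specialUnitaryGroup n ℂ) : Matrix n n ℂ) *
            a ⟨p.src.shift p.ν, p.μ⟩ * star ((U ⟨p.src, p.μ⟩ * U ⟨p.src.shift p.μ, p.ν⟩ * (U ⟨p.src.shift p.ν, p.μ⟩)⁻¹ : Matrix.specialUnitaryGroup n ℂ) : Matrix n n ℂ))) *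
      exp (-(((GaugeField.plaqHol U p : Matrix.specialUnitaryGroup n ℂ) : Matrix n n ℂ) * a ⟨p.src, p.ν⟩ *
            star ((GaugeField.plaqHol U p : Matrix.specialUnitaryGroup n ℂ) : Matrix n n ℂ))) *
      ((GaugeField.plaqHol U p : Matrix.specialUnitaryGroup n ℂ) : Matrix n n ℂ) := by
  -- names
  set b₁ : PBond P j := ⟨p.src, p.μ⟩
  set b₂ : PBond P j := ⟨p.src.shift p.μ, p.ν⟩
  set b₃ : PBond P j := ⟨p.src.shift p.ν, p.μ⟩
  set b₄ : PBond P j := ⟨p.src, p.ν⟩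
  have hW : ((GaugeField.plaqHol U p : Matrix.specialUnitaryGroup n ℂ) : Matrix n n ℂ) =
      (U b₁ : Matrix n n ℂ) * (U b₂ : Matrix n n ℂ) * star (U b₃ : Matrix n n ℂ) * star (U b₄ : Matrix n n ℂ) := by
    simp only [GaugeField.plaqHol, Submonoid.coe_mul, coe_inv_eq_star, b₁, b₂, b₃, b₄]
  have hW' : ((GaugeField.plaqHol U' p : Matrix.specialUnitaryGroup n ℂ) : Matrix n n ℂ) =
      (U' b₁ : Matrix n n ℂ) * (U' b₂ : Matrix n n ℂ) * star (U' b₃ : Matrix n n ℂ) * star (U' b₄ : Matrix n n ℂ) := by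
    simp only [GaugeField.plaqHol, Submonoid.coe_mul, coe_inv_eq_star, b₁, b₂, b₃, b₄]
  have hg : (((U b₁ * U b₂ * (U b₃)⁻¹ : Matrix.specialUnitaryGroup n ℂ)) : Matrix n n ℂ) =
      (U b₁ : Matrix n n ℂ) * (U b₂ : Matrix n n ℂ) * star (U b₃ : Matrix n n ℂ) := by
    simp only [Submonoid.coe_mul, coe_inv_eq_star]
  -- star of an exponential of a skew element
  have hse : ∀ b, star (exp (a b)) = exp (-a b) := fun b => by rw [star_exp, hstar]
  rw [hW', hU' b₁, hU' b₂, hU' b₃, hU' b₄, star_mul, star_mul, hse, hse, hg, hW]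
  -- move the exponentials to the left one by one
  set U₁ := (U b₁ : Matrix n n ℂ)
  set U₂ := (U b₂ : Matrix n n ℂ)
  set U₃ := (U b₃ : Matrix n n ℂ)
  set U₄ := (U b₄ : Matrix n n ℂ)
  have s2 : U₁ * exp (a b₂) = exp (U₁ * a b₂ * star U₁) * U₁ := coe_mul_exp_eq (U b₁) (a b₂)
  have s3 : U₁ * U₂ * star U₃ * exp (-a b₃) = exp (U₁ * U₂ * star U₃ * (-a b₃) * star (U₁ * U₂ * star U₃)) * (U₁ * U₂ * star U₃) := by
    have := coe_mul_exp_eq (U b₁ * U b₂ * (U b₃)⁻¹) (-a b₃)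
    rwa [hg] at this
  have s4 : U₁ * U₂ * star U₃ * star U₄ * exp (-a b₄) =
      exp (U₁ * U₂ * star U₃ * star U₄ * (-a b₄) * star (U₁ * U₂ * star U₃ * star U₄)) * (U₁ * U₂ * star U₃ * star U₄) := by
    have := coe_mul_exp_eq (GaugeField.plaqHol U p) (-a b₄)
    rwa [hW] at this
  calc exp (a b₁) * U₁ * (exp (a b₂) * U₂) * (star U₃ * exp (-a b₃)) * (star U₄ * exp (-a b₄))
      = exp (a b₁) * (U₁ * exp (a b₂)) * U₂ * star U₃ * exp (-a b₃) * star U₄ * exp (-a b₄) := by noncomm_ring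
    _ = exp (a b₁) * exp (U₁ * a b₂ * star U₁) * (U₁ * U₂ * star U₃ * exp (-a b₃)) * star U₄ * exp (-a b₄) := by rw [s2]; noncomm_ring
    _ = exp (a b₁) * exp (U₁ * a b₂ * star U₁) * exp (U₁ * U₂ * star U₃ * (-a b₃) * star (U₁ * U₂ * star U₃)) *
          (U₁ * U₂ * star U₃ * star U₄ * exp (-a b₄)) := by rw [s3]; noncomm_ring
    _ = exp (a b₁) * exp (U₁ * a b₂ * star U₁) * exp (U₁ * U₂ * star U₃ * (-a b₃) * star (U₁ * U₂ * star U₃)) *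
          exp (U₁ * U₂ * star U₃ * star U₄ * (-a b₄) * star (U₁ * U₂ * star U₃ * star U₄)) * (U₁ * U₂ * star U₃ * star U₄) := by
          rw [s4]; noncomm_ring
    _ = _ := by
          congr 2
          · congr 2
            rw [mul_neg, neg_mul]
          · rw [mul_neg, neg_mul]

/-! ## §3 The covariant plaquette ledger -/

/-- **★★ THE COVARIANT PLAQUETTE LEDGER** (upper bound).  With `U′_b = e^{a_b}U_b`, `a_b* = −a_b`, `‖a_b‖ ≤ δ` on the four bonds of `p`, `W = U(∂p)`, `g = U₁U₂U₃⁻¹`: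
`dist1 U′(∂p) ≤ dist1 U(∂p) + ‖a₁ + U₁a₂U₁* − g a₃ g* − W a₄ W*‖ + (e^{4δ} − 1 − 4δ)` — the plaquette of the perturbed field is the background plaquette plus the COVARIANT CURL of the
perturbation, up to second order in `δ`; valid at ANY background (`O(1)` bond variables allowed).  From §2: `U′(∂p) − 1 = (W − 1) + (Σxᵢ)·W + (Πe^{xᵢ} − 1 − Σxᵢ)·W`, `‖xᵢ‖ = ‖aᵢ‖`.
[cite: Balaban1985Averaging, (9) p.19, (19) p.21] -/
theorem dist1_plaqHol_perturb_le (U U' : GaugeField P j (Matrix.specialUnitaryGroup n ℂ)) (a : PBond P j → Matrix n n ℂ)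
    (hstar : ∀ b, star (a b) = -a b) (hU' : ∀ b, ((U' b : Matrix.specialUnitaryGroup n ℂ) : Matrix n n ℂ) = exp (a b) * (U b : Matrix n n ℂ))
    (p : Plaq P j) {δ : ℝ} (h₁ : ‖a ⟨p.src, p.μ⟩‖ ≤ δ) (h₂ : ‖a ⟨p.src.shift p.μ, p.ν⟩‖ ≤ δ) (h₃ : ‖a ⟨p.src.shift p.ν, p.μ⟩‖ ≤ δ) (h₄ : ‖a ⟨p.src, p.ν⟩‖ ≤ δ) :
    GaugeGroup.dist1 (GaugeField.plaqHol U' p) ≤ GaugeGroup.dist1 (GaugeField.plaqHol U p) +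
      ‖a ⟨p.src, p.μ⟩ + (U ⟨p.src, p.μ⟩ : Matrix n n ℂ) * a ⟨p.src.shift p.μ, p.ν⟩ * star (U ⟨p.src, p.μ⟩ : Matrix n n ℂ)
        - ((U ⟨p.src, p.μ⟩ * U ⟨p.src.shift p.μ, p.ν⟩ * (U ⟨p.src.shift p.ν, p.μ⟩)⁻¹ : Matrix.specialUnitaryGroup n ℂ) : Matrix n n ℂ) * a ⟨p.src.shift p.ν, p.μ⟩ *
            star ((U ⟨p.src, p.μ⟩ * U ⟨p.src.shift p.μ, p.ν⟩ * (U ⟨p.src.shift p.ν, p.μ⟩)⁻¹ : Matrix.specialUnitaryGroup n ℂ) : Matrix n n ℂ)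
        - ((GaugeField.plaqHol U p : Matrix.specialUnitaryGroup n ℂ) : Matrix n n ℂ) * a ⟨p.src, p.ν⟩ *
            star ((GaugeField.plaqHol U p : Matrix.specialUnitaryGroup n ℂ) : Matrix n n ℂ)‖ +
      (Real.exp (4 * δ) - 1 - 4 * δ) := by
  set g : Matrix.specialUnitaryGroup n ℂ := U ⟨p.src, p.μ⟩ * U ⟨p.src.shift p.μ, p.ν⟩ * (U ⟨p.src.shift p.ν, p.μ⟩)⁻¹ with hg
  set W : Matrix.specialUnitaryGroup n ℂ := GaugeField.plaqHol U p with hWdef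
  set x₁ : Matrix n n ℂ := a ⟨p.src, p.μ⟩
  set x₂ : Matrix n n ℂ := (U ⟨p.src, p.μ⟩ : Matrix n n ℂ) * a ⟨p.src.shift p.μ, p.ν⟩ * star (U ⟨p.src, p.μ⟩ : Matrix n n ℂ)
  set x₃ : Matrix n n ℂ := -((g : Matrix n n ℂ) * a ⟨p.src.shift p.ν, p.μ⟩ * star (g : Matrix n n ℂ))
  set x₄ : Matrix n n ℂ := -((W : Matrix n n ℂ) * a ⟨p.src, p.ν⟩ * star (W : Matrix n n ℂ))
  have hid : ((GaugeField.plaqHol U' p : Matrix.specialUnitaryGroup n ℂ) : Matrix n n ℂ) = exp x₁ * exp x₂ * exp x₃ * exp x₄ * (W : Matrix n n ℂ) :=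
    coe_plaqHol_perturb_eq U U' a hstar hU' p
  have n₁ : ‖x₁‖ ≤ δ := h₁
  have n₂ : ‖x₂‖ ≤ δ := by rw [norm_conj_SU]; exact h₂
  have n₃ : ‖x₃‖ ≤ δ := by rw [norm_neg, norm_conj_SU]; exact h₃
  have n₄ : ‖x₄‖ ≤ δ := by rw [norm_neg, norm_conj_SU]; exact h₄
  have hE := norm_prodExp_four_sub_one_sub_sum_le x₁ x₂ x₃ x₄ n₁ n₂ n₃ n₄
  rw [dist1_SU_eq, dist1_SU_eq, hid]
  have e : exp x₁ * exp x₂ * exp x₃ * exp x₄ * (W : Matrix n n ℂ) - 1 =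
      ((W : Matrix n n ℂ) - 1) + (x₁ + x₂ + x₃ + x₄) * (W : Matrix n n ℂ) +
        (exp x₁ * exp x₂ * exp x₃ * exp x₄ - 1 - (x₁ + x₂ + x₃ + x₄)) * (W : Matrix n n ℂ) := by noncomm_ring
  rw [e]
  have hsum : x₁ + x₂ + x₃ + x₄ = a ⟨p.src, p.μ⟩ + (U ⟨p.src, p.μ⟩ : Matrix n n ℂ) * a ⟨p.src.shift p.μ, p.ν⟩ * star (U ⟨p.src, p.μ⟩ : Matrix n n ℂ)
        - (g : Matrix n n ℂ) * a ⟨p.src.shift p.ν, p.μ⟩ * star (g : Matrix n n ℂ) - (W : Matrix n n ℂ) * a ⟨p.src, p.ν⟩ * star (W : Matrix n n ℂ) := by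
    simp only [x₁, x₂, x₃, x₄]; abel
  calc ‖((W : Matrix n n ℂ) - 1) + (x₁ + x₂ + x₃ + x₄) * (W : Matrix n n ℂ) + (exp x₁ * exp x₂ * exp x₃ * exp x₄ - 1 - (x₁ + x₂ + x₃ + x₄)) * (W : Matrix n n ℂ)‖
      ≤ ‖(W : Matrix n n ℂ) - 1‖ + ‖(x₁ + x₂ + x₃ + x₄) * (W : Matrix n n ℂ)‖ + ‖(exp x₁ * exp x₂ * exp x₃ * exp x₄ - 1 - (x₁ + x₂ + x₃ + x₄)) * (W : Matrix n n ℂ)‖ :=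
        norm_add₃_le
    _ = ‖(W : Matrix n n ℂ) - 1‖ + ‖x₁ + x₂ + x₃ + x₄‖ + ‖exp x₁ * exp x₂ * exp x₃ * exp x₄ - 1 - (x₁ + x₂ + x₃ + x₄)‖ := by
        rw [CStarRing.norm_mul_mem_unitary _ W.2.1, CStarRing.norm_mul_mem_unitary _ W.2.1]
    _ ≤ ‖(W : Matrix n n ℂ) - 1‖ + ‖x₁ + x₂ + x₃ + x₄‖ + (Real.exp (4 * δ) - 1 - 4 * δ) := by gcongr
    _ = _ := by rw [hsum]

/-- **THE COVARIANT CURL FROM THE TWO PLAQUETTES** (lower companion): `‖a₁ + U₁a₂U₁* − g a₃ g* − W a₄ W*‖ ≤ dist1 U′(∂p) + dist1 U(∂p) + (e^{4δ} − 1 − 4δ)` — so, at a regular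
background and a regular perturbed field, the covariant curl of the perturbation is itself second-order-small. [cite: Balaban1985Averaging, (9) p.19, (19) p.21] -/
theorem norm_covCurl_le (U U' : GaugeField P j (Matrix.specialUnitaryGroup n ℂ)) (a : PBond P j → Matrix n n ℂ)
    (hstar : ∀ b, star (a b) = -a b) (hU' : ∀ b, ((U' b : Matrix.specialUnitaryGroup n ℂ) : Matrix n n ℂ) = exp (a b) * (U b : Matrix n n ℂ))
    (p : Plaq P j) {δ : ℝ} (h₁ : ‖a ⟨p.src, p.μ⟩‖ ≤ δ) (h₂ : ‖a ⟨p.src.shift p.μ, p.ν⟩‖ ≤ δ) (h₃ : ‖a ⟨p.src.shift p.ν, p.μ⟩‖ ≤ δ) (h₄ : ‖a ⟨p.src, p.ν⟩‖ ≤ δ) :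
    ‖a ⟨p.src, p.μ⟩ + (U ⟨p.src, p.μ⟩ : Matrix n n ℂ) * a ⟨p.src.shift p.μ, p.ν⟩ * star (U ⟨p.src, p.μ⟩ : Matrix n n ℂ)
        - ((U ⟨p.src, p.μ⟩ * U ⟨p.src.shift p.μ, p.ν⟩ * (U ⟨p.src.shift p.ν, p.μ⟩)⁻¹ : Matrix.specialUnitaryGroup n ℂ) : Matrix n n ℂ) * a ⟨p.src.shift p.ν, p.μ⟩ *
            star ((U ⟨p.src, p.μ⟩ * U ⟨p.src.shift p.μ, p.ν⟩ * (U ⟨p.src.shift p.ν, p.μ⟩)⁻¹ : Matrix.specialUnitaryGroup n ℂ) : Matrix n n ℂ)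
        - ((GaugeField.plaqHol U p : Matrix.specialUnitaryGroup n ℂ) : Matrix n n ℂ) * a ⟨p.src, p.ν⟩ *
            star ((GaugeField.plaqHol U p : Matrix.specialUnitaryGroup n ℂ) : Matrix n n ℂ)‖ ≤
      GaugeGroup.dist1 (GaugeField.plaqHol U' p) + GaugeGroup.dist1 (GaugeField.plaqHol U p) + (Real.exp (4 * δ) - 1 - 4 * δ) := by
  set g : Matrix.specialUnitaryGroup n ℂ := U ⟨p.src, p.μ⟩ * U ⟨p.src.shift p.μ, p.ν⟩ * (U ⟨p.src.shift p.ν, p.μ⟩)⁻¹ with hg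
  set W : Matrix.specialUnitaryGroup n ℂ := GaugeField.plaqHol U p with hWdef
  set x₁ : Matrix n n ℂ := a ⟨p.src, p.μ⟩
  set x₂ : Matrix n n ℂ := (U ⟨p.src, p.μ⟩ : Matrix n n ℂ) * a ⟨p.src.shift p.μ, p.ν⟩ * star (U ⟨p.src, p.μ⟩ : Matrix n n ℂ)
  set x₃ : Matrix n n ℂ := -((g : Matrix n n ℂ) * a ⟨p.src.shift p.ν, p.μ⟩ * star (g : Matrix n n ℂ))
  set x₄ : Matrix n n ℂ := -((W : Matrix n n ℂ) * a ⟨p.src, p.ν⟩ * star (W : Matrix n n ℂ))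
  have hid : ((GaugeField.plaqHol U' p : Matrix.specialUnitaryGroup n ℂ) : Matrix n n ℂ) = exp x₁ * exp x₂ * exp x₃ * exp x₄ * (W : Matrix n n ℂ) :=
    coe_plaqHol_perturb_eq U U' a hstar hU' p
  have n₁ : ‖x₁‖ ≤ δ := h₁
  have n₂ : ‖x₂‖ ≤ δ := by rw [norm_conj_SU]; exact h₂
  have n₃ : ‖x₃‖ ≤ δ := by rw [norm_neg, norm_conj_SU]; exact h₃
  have n₄ : ‖x₄‖ ≤ δ := by rw [norm_neg, norm_conj_SU]; exact h₄
  have hE := norm_prodExp_four_sub_one_sub_sum_le x₁ x₂ x₃ x₄ n₁ n₂ n₃ n₄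
  rw [dist1_SU_eq, dist1_SU_eq, hid]
  have e : (x₁ + x₂ + x₃ + x₄) * (W : Matrix n n ℂ) = (exp x₁ * exp x₂ * exp x₃ * exp x₄ * (W : Matrix n n ℂ) - 1)
      - ((W : Matrix n n ℂ) - 1) - (exp x₁ * exp x₂ * exp x₃ * exp x₄ - 1 - (x₁ + x₂ + x₃ + x₄)) * (W : Matrix n n ℂ) := by noncomm_ring
  have hsum : x₁ + x₂ + x₃ + x₄ = a ⟨p.src, p.μ⟩ + (U ⟨p.src, p.μ⟩ : Matrix n n ℂ) * a ⟨p.src.shift p.μ, p.ν⟩ * star (U ⟨p.src, p.μ⟩ : Matrix n n ℂ)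
        - (g : Matrix n n ℂ) * a ⟨p.src.shift p.ν, p.μ⟩ * star (g : Matrix n n ℂ) - (W : Matrix n n ℂ) * a ⟨p.src, p.ν⟩ * star (W : Matrix n n ℂ) := by
    simp only [x₁, x₂, x₃, x₄]; abel
  rw [← hsum, ← CStarRing.norm_mul_mem_unitary (x₁ + x₂ + x₃ + x₄) W.2.1, e]
  calc ‖(exp x₁ * exp x₂ * exp x₃ * exp x₄ * (W : Matrix n n ℂ) - 1) - ((W : Matrix n n ℂ) - 1) -
          (exp x₁ * exp x₂ * exp x₃ * exp x₄ - 1 - (x₁ + x₂ + x₃ + x₄)) * (W : Matrix n n ℂ)‖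
      ≤ ‖exp x₁ * exp x₂ * exp x₃ * exp x₄ * (W : Matrix n n ℂ) - 1‖ + ‖(W : Matrix n n ℂ) - 1‖ +
          ‖(exp x₁ * exp x₂ * exp x₃ * exp x₄ - 1 - (x₁ + x₂ + x₃ + x₄)) * (W : Matrix n n ℂ)‖ :=
        (norm_sub_le _ _).trans (add_le_add (norm_sub_le _ _) le_rfl)
    _ = ‖exp x₁ * exp x₂ * exp x₃ * exp x₄ * (W : Matrix n n ℂ) - 1‖ + ‖(W : Matrix n n ℂ) - 1‖ +
          ‖exp x₁ * exp x₂ * exp x₃ * exp x₄ - 1 - (x₁ + x₂ + x₃ + x₄)‖ := by rw [CStarRing.norm_mul_mem_unitary _ W.2.1]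
    _ ≤ _ := by gcongr

/-- **THE LEDGER WITH A FLAT LAST SLOT**: reading the fourth perturbation untransported (`−a₄` instead of `−W a₄ W*`) costs `2δ·dist1 U(∂p)`:
`dist1 U′(∂p) ≤ (1 + 2δ)·dist1 U(∂p) + ‖a₁ + U₁a₂U₁* − g a₃ g* − a₄‖ + (e^{4δ} − 1 − 4δ)` — the form used when the background plaquette is itself `O(ε·L^{−2k})`.
[cite: Balaban1985Averaging, (9) p.19, (19) p.21] -/
theorem dist1_plaqHol_perturb_le_flatLast (U U' : GaugeField P j (Matrix.specialUnitaryGroup n ℂ)) (a : PBond P j → Matrix n n ℂ)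
    (hstar : ∀ b, star (a b) = -a b) (hU' : ∀ b, ((U' b : Matrix.specialUnitaryGroup n ℂ) : Matrix n n ℂ) = exp (a b) * (U b : Matrix n n ℂ))
    (p : Plaq P j) {δ : ℝ} (h₁ : ‖a ⟨p.src, p.μ⟩‖ ≤ δ) (h₂ : ‖a ⟨p.src.shift p.μ, p.ν⟩‖ ≤ δ) (h₃ : ‖a ⟨p.src.shift p.ν, p.μ⟩‖ ≤ δ) (h₄ : ‖a ⟨p.src, p.ν⟩‖ ≤ δ) :
    GaugeGroup.dist1 (GaugeField.plaqHol U' p) ≤ (1 + 2 * δ) * GaugeGroup.dist1 (GaugeField.plaqHol U p) +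
      ‖a ⟨p.src, p.μ⟩ + (U ⟨p.src, p.μ⟩ : Matrix n n ℂ) * a ⟨p.src.shift p.μ, p.ν⟩ * star (U ⟨p.src, p.μ⟩ : Matrix n n ℂ)
        - ((U ⟨p.src, p.μ⟩ * U ⟨p.src.shift p.μ, p.ν⟩ * (U ⟨p.src.shift p.ν, p.μ⟩)⁻¹ : Matrix.specialUnitaryGroup n ℂ) : Matrix n n ℂ) * a ⟨p.src.shift p.ν, p.μ⟩ *
            star ((U ⟨p.src, p.μ⟩ * U ⟨p.src.shift p.μ, p.ν⟩ * (U ⟨p.src.shift p.ν, p.μ⟩)⁻¹ : Matrix.specialUnitaryGroup n ℂ) : Matrix n n ℂ)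
        - a ⟨p.src, p.ν⟩‖ +
      (Real.exp (4 * δ) - 1 - 4 * δ) := by
  have h := dist1_plaqHol_perturb_le U U' a hstar hU' p h₁ h₂ h₃ h₄
  set W : Matrix.specialUnitaryGroup n ℂ := GaugeField.plaqHol U p with hWdef
  set g : Matrix.specialUnitaryGroup n ℂ := U ⟨p.src, p.μ⟩ * U ⟨p.src.shift p.μ, p.ν⟩ * (U ⟨p.src.shift p.ν, p.μ⟩)⁻¹ with hg
  set C : Matrix n n ℂ := a ⟨p.src, p.μ⟩ + (U ⟨p.src, p.μ⟩ : Matrix n n ℂ) * a ⟨p.src.shift p.μ, p.ν⟩ * star (U ⟨p.src, p.μ⟩ : Matrix n n ℂ)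
        - (g : Matrix n n ℂ) * a ⟨p.src.shift p.ν, p.μ⟩ * star (g : Matrix n n ℂ) with hC
  have hconj := norm_conj_sub_self_le' W (a ⟨p.src, p.ν⟩)
  have hδ : 0 ≤ δ := (norm_nonneg _).trans h₁
  have key : ‖C - (W : Matrix n n ℂ) * a ⟨p.src, p.ν⟩ * star (W : Matrix n n ℂ)‖ ≤ ‖C - a ⟨p.src, p.ν⟩‖ + 2 * ‖(W : Matrix n n ℂ) - 1‖ * δ := by
    have e : C - (W : Matrix n n ℂ) * a ⟨p.src, p.ν⟩ * star (W : Matrix n n ℂ) =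
        (C - a ⟨p.src, p.ν⟩) - ((W : Matrix n n ℂ) * a ⟨p.src, p.ν⟩ * star (W : Matrix n n ℂ) - a ⟨p.src, p.ν⟩) := by abel
    rw [e]
    refine (norm_sub_le _ _).trans (add_le_add le_rfl (hconj.trans ?_))
    exact mul_le_mul_of_nonneg_left h₄ (by positivity)
  simp only [dist1_SU_eq] at h ⊢
  have hW0 : 0 ≤ ‖(W : Matrix n n ℂ) - 1‖ := norm_nonneg _
  nlinarith [key, h, hW0, hδ]

end Matrices

end Summit.QuantumFields.YangMills.Theorems.PerturbedPlaquette

end
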